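import Summits.AtomisticToContinuum.BoseEinsteinCondensation.Theses.BECRewardDescent

/-!
# AtomisticToContinuum / BoseEinsteinCondensation — route `BECRewardDescent`, assembly

Settles the assembly item `stmt-AtomisticToContinuum-12881` of route
`route-AtomisticToContinuum-BECRewardDescent`: the implication

  `RewardScaleChord → RewardChordBound → PeriodicEnergyFinite → PeriodicRigidity →
    RigidCondensation → BoundaryTransferWeak → BoseEinsteinCondensation`

(the audited sub-problem statement `_root_.BoseEinsteinCondensation`, by name).

The hypotheses of `Assembly` are, verbatim and in the same order, those of the route's sorry-free
deciding theorem `Theses.BECRewardDescent.closes` (axioms `propext`, `Classical.choice`,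
`Quot.sound`), so the assembly is that theorem curried. For the record, `closes` runs as follows:
fix a repulsive finite-range `v`; `RewardChordBound` with `τ = 1/8` gives `θ, ρ₁`,
`RewardScaleChord` with `(τ, θ) = (1/8, θ)` gives `ρ₂`, `PeriodicEnergyFinite` gives `ρ₃` and
`PeriodicRigidity` gives `ρ₄`; for `ρ < min ρᵢ` and eventually in `N`, with `s₀ := θρ·a.toReal`,
either `s₀ = 0` (then the reward-scale rung holds for every `s > 0`) or `s₀ > 0` (then the chord
bound on `(0, s₀]` plus the rung at `s₀`, after cancelling the finite term `(s/s₀)·E₀^per` in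
`ℝ≥0∞`) give `R(s) ≤ E₀^per + s·(2·1/8)·N` on an interval `(0, s₁]`; `RigidCondensation` with
`τ = 1/4` turns this, `E₀^per ≠ ⊤` and the rigidity body into condensation `n₀ ≥ N/2` of all
`δ`-near-minimisers (periodic BEC for `v` with `c = 1/2`), and `BoundaryTransferWeak v` carries it
to `∃ ρ₀ > 0, ∀ ρ ∈ (0, ρ₀), HasGroundStateBEC v ρ`, i.e. the conjunct. Pure logic; no analytic
content lives in this file.

References: [LSSY2005, §1.2 and Ch. 5] (the conjunct being assembled),
[LauwersVerbeureZagrebnov2003, Thm 2] (the gapped-BEC programme the route quantifies).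
-/

namespace Summit.AtomisticToContinuum.BoseEinsteinCondensation.Theorems

/-- Settles `stmt-AtomisticToContinuum-12881` (exact signature): the assembly of route
`BECRewardDescent`, i.e. its six items `RewardScaleChord`, `RewardChordBound`,
`PeriodicEnergyFinite`, `PeriodicRigidity`, `RigidCondensation`, `BoundaryTransferWeak` imply the
sub-problem statement `BoseEinsteinCondensation`. Proof: the route's deciding theorem
`Theses.BECRewardDescent.closes`, whose hypotheses are these six items in this order, curried.
[folklore] -/
theorem becRewardDescent_assembly_proof :
    Summit.AtomisticToContinuum.BoseEinsteinCondensation.Theses.BECRewardDescent.Assembly := by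
  unfold Theses.BECRewardDescent.Assembly
  intro hRS hCB hFin hRig hRC hBT
  exact Theses.BECRewardDescent.closes hRS hCB hFin hRig hRC hBT

end Summit.AtomisticToContinuum.BoseEinsteinCondensation.Theorems
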